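import Summits.QuantumFields.BalabanUV.Beta.EriceFlowEnclosureB12AsPrintedPointwiseFace
import Summits.QuantumFields.BalabanUV.Beta.EriceFlowEnclosureB12AsPrintedPointwiseUniformIff

/-!
# Beta / EriceFlowEnclosureB12AsPrintedPointwiseFaceIff — WHAT (0.31) FORCES POINTWISE, part 9 END: THE g-UNIFORM (0.31) *IS* ASYMPTOTIC FREEDOM OF THE FACE SEQUENCE.  Part 9
# (`…PointwiseFace`) read Theorem 2 through the face g_k = 0 ((2.13)'s printed remark: β_{k+1}(·, 0) is history-free) with the cell's (AF-1) letter `BetaDerivClause.LastVarLipschitzAtZero` alone: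
# the g-uniform cpl-form of (0.31) forces β ln L ≤ β_{k+1}(q_{<k}, 0) at every scale.  Conversely a positive lower bound b on the face values plus (AF-1) is the AF letter `BetaLowerH (b − Cδ) δ` on
# small boxes, and with (U) + (C) part 3's `uniformTheorem2_of_letters` (#59f, prover 1's forward shooting on the carrier) returns the g-uniform (0.31) and Theorem 2 AS TYPED.  Hence, under the
# printed `Definitions`, (U) with b′γ_U² < 1, (C) and (AF-1) on ]0, γ_U]: **`uniformTheorem2_iff_faceAF`** — «(0.31) with constants uniform in g» ⟺ «∃ b > 0, β_{k+1}(·, 0) ≥ b at every scale»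
# (ASYMPTOTIC FREEDOM OF THE FACE ∕ «ONE-LOOP» SEQUENCE — the pointwise form of row D1's drift letter); and **`theorem2Statement_of_faceAF`**: face AF ⟹ [I] Theorem 2 AS TYPED.  No Markov
# letter, no injectivity, no uniqueness, no history moduli anywhere
# (β-flow team, prover 2 = lower ∕ positivity side, unit `b2b-balaban-beta-bflow-p2`, gen 44; ROW AP-I × row D4's face letter × (AF-1); companion of part 9)

HONEST FRAMING (page 1 of everything the β sub-cell writes): discharging `BetaPertH` makes Bałaban's UV stability UNCONDITIONAL — a
real constructive-QFT result; it is NOT the continuum limit and NOT the Clay problem.  HONEST DEPENDENCY (cell reorg 2026-08-19,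
verbatim): «continuum YM on T⁴ ⇐ BetaPertH ∧ nine spine estimates (0/9 proved); BetaPertH ⇐ (D1) ∧ (D4) ∧ CAP+tail; G-an2-4 gates
asym, D1 and NE2/3/4.»  THIS MODULE DISCHARGES NOTHING: bookkeeping from the NAMED FIELDS of the statement-exact typing `B12BetaAsPrinted` of [I] = T. Bałaban, Commun. Math.
Phys. **109** (1987) [Balaban1987RG1] (`Definitions`; `Theorem2Statement` — STATED WITHOUT PROOF p. 259 — DERIVED here from letters, never asserted), the letters (U) (p. 264), (C)
(pp. 263–264) and the cell's (AF-1) (p. 264's clause made k-uniform — UNPRINTED uniformity), and the READING `hTu`.  Whether Bałaban's face ∕ one-loop values are positive is row D1's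
question (not touched); nothing of (1.22) is asserted.

WHAT THIS FILE PROVES (0 sorry, 0 def): `betaLowerH_of_faceAF` (face AF + (AF-1) ⟹ `BetaLowerH (b − Cδ) δ`), **`theorem2Statement_of_faceAF`**, **`uniformTheorem2_iff_faceAF`**.
NOT CLAIMED: the sign of Bałaban's one-loop coefficients; any letter for Bałaban's β; which reading print intends; Theorem 2; `BetaPertH`; continuum; Clay.
-/

namespace Summit.QuantumFields.BalabanUV.Beta.EriceFlowEnclosureB12AsPrintedPointwiseFaceIff

open Literature.MathematicalPhysics.QuantumFieldTheory.Balaban1983to89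
open Literature.MathematicalPhysics.QuantumFieldTheory.Balaban1983to89.B12BetaAsPrinted
open Literature.MathematicalPhysics.QuantumFieldTheory.Balaban1983to89.FlowStep (HBeta prefixOf Box mem_box box_mono RGEqH BetaUpperH BetaLowerH
  BetaContH histBox_eq_box)
open Literature.MathematicalPhysics.QuantumFieldTheory.Balaban1983to89.BetaDerivClause (LastVarLipschitzAtZero)
open Summit.QuantumFields.BalabanUV.Beta.EriceFlowEnclosureB12AsPrintedTunedUpper (hrg_of_betaUpperH)
open Summit.QuantumFields.BalabanUV.Beta.EriceFlowEnclosureB12AsPrintedPointwiseUniformIff (uniformTheorem2_of_letters)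
open Summit.QuantumFields.BalabanUV.Beta.EriceFlowEnclosureB12AsPrintedPointwiseFace (face_bounds_of_uniformTheorem2_AF1)

noncomputable section

variable {S : Setting}

/-- **FACE AF + (AF-1) ⟹ THE AF LETTER ON SMALL BOXES**: if `β_{k+1}(q_{<k}, 0) ≥ b` at every scale for q ∈ ]0, γ_U]^{k+1} and `LastVarLipschitzAtZero S.β C γ_U`, then `BetaLowerH (b − Cδ) δ S.β` for every
δ ≤ γ_U (the history-typed form of `FlowStep.betaLowerH_of_split`, with the face value in place of the split's β⁰). [cite: Balaban1987RG1, §1 p.264 with (2.13) p.268] -/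
theorem betaLowerH_of_faceAF {γU b C : ℝ} (hC : 0 ≤ C)
    (hface : ∀ (k : ℕ) (q : Fin (k + 1) → ℝ), q ∈ Box γU k → b ≤ S.β k (Function.update q (Fin.last k) 0))
    (hAF1 : LastVarLipschitzAtZero S.β C γU) {δ : ℝ} (hδU : δ ≤ γU) : BetaLowerH (b - C * δ) δ S.β := by
  intro k p hp
  have hpU : p ∈ Box γU k := box_mono hδU k hp
  have h1 := (abs_le.mp (hAF1 k p ((histBox_eq_box γU k).symm ▸ hpU))).1
  have h2 := hface k p hpU
  have h3 : C * p (Fin.last k) ≤ C * δ := mul_le_mul_of_nonneg_left ((mem_box.mp hp) (Fin.last k)).2 hC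
  linarith

/-- **ASYMPTOTIC FREEDOM OF THE FACE SEQUENCE ⟹ [I] THEOREM 2 AS TYPED (and the g-uniform (0.31)).**  The printed `Definitions`, L odd > 1, the letters (U) `β_{k+1} ≤ b′` and (C) on ]0, γ_U]^{k+1},
(AF-1) `LastVarLipschitzAtZero S.β C γ_U`, and a positive lower bound b on the face values `β_{k+1}(q_{<k}, 0)` ⟹ the g-uniform cpl-form of (0.31) AND `Theorem2Statement S hL` (part 3's
`uniformTheorem2_of_letters` on the box δ = min(γ_U, b∕(2C+1)), where the AF letter holds with constant b∕2). [cite: Balaban1987RG1, Thm 2 (0.31) p.259 with §1 p.264 and (2.13) p.268] -/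
theorem theorem2Statement_of_faceAF (hD : Definitions S) (hL : Odd S.L ∧ 1 < S.L) {γU b b' C : ℝ} (hγU : 0 < γU) (hb : 0 < b) (hC : 0 ≤ C)
    (hcont : BetaContH γU S.β) (hup : BetaUpperH b' γU S.β)
    (hface : ∀ (k : ℕ) (q : Fin (k + 1) → ℝ), q ∈ Box γU k → b ≤ S.β k (Function.update q (Fin.last k) 0))
    (hAF1 : LastVarLipschitzAtZero S.β C γU) :
    (∀ m : ℕ, ∃ γ₁ : ℝ, 0 < γ₁ ∧ ∀ γ : ℝ, 0 < γ → γ ≤ γ₁ → ∃ g₁ : ℝ, 0 < g₁ ∧ ∃ β β' : ℝ, 0 < β ∧ β ≤ β' ∧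
      ∀ g : ℝ, 0 < g → g ≤ g₁ → ∀ K : ℕ, ∃ g₀ : ℝ, Step.InInterval γ K (S.cpl ⟨K, m, g₀⟩) ∧ S.cpl ⟨K, m, g₀⟩ K = g ∧
        Step.Discrete031 (β * Real.log S.L) (β' * Real.log S.L) K g (S.cpl ⟨K, m, g₀⟩)) ∧ Theorem2Statement S hL := by
  -- the small box δ with Cδ ≤ b/2
  set δ : ℝ := min γU (b / (2 * C + 1)) with hδ
  have hδpos : 0 < δ := lt_min hγU (by positivity)
  have hδU : δ ≤ γU := min_le_left _ _
  have hCδ : C * δ ≤ b / 2 := by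
    have h1 : C * δ ≤ C * (b / (2 * C + 1)) := mul_le_mul_of_nonneg_left (min_le_right _ _) hC
    have h2 : C * (b / (2 * C + 1)) ≤ b / 2 := by
      rw [mul_div_assoc', div_le_iff₀ (by positivity : (0 : ℝ) < 2 * C + 1)]
      have e : b / 2 * (2 * C + 1) = C * b + b / 2 := by ring
      rw [e]; linarith
    exact h1.trans h2
  have hlo : BetaLowerH (b / 2) δ S.β := fun k p hp => by
    have h := betaLowerH_of_faceAF hC hface hAF1 hδU k p hp
    linarith
  have hupδ : BetaUpperH (max b' (b / 2)) δ S.β := fun k p hp => (hup k p (box_mono hδU k hp)).trans (le_max_left _ _)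
  have hcontδ : BetaContH δ S.β := fun k => (hcont k).mono (box_mono hδU k)
  exact uniformTheorem2_of_letters hD hL hδpos (by positivity) (le_max_right _ _) hcontδ hlo hupδ

/-- **THE g-UNIFORM (0.31) *IS* ASYMPTOTIC FREEDOM OF THE FACE SEQUENCE.**  Under the printed `Definitions`, L odd > 1, (U) `β_{k+1} ≤ b′` on ]0, γ_U]^{k+1} with b′γ_U² < 1 (γ_U ≤ γ), (C)
`BetaContH γ_U` and the cell's (AF-1) `LastVarLipschitzAtZero S.β C γ_U`: the g-uniform cpl-form `hTu` of Theorem 2 ⟺ «∃ b > 0 with β_{k+1}(q_{<k}, 0) ≥ b for every scale k and every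
q ∈ ]0, γ_U]^{k+1}».  (⟹) part 9 `face_bounds_of_uniformTheorem2_AF1` (b = β ln L; the binder `hrg` from (U)); (⟸) `theorem2Statement_of_faceAF`.  No Markov letter, no injectivity, no uniqueness,
no history moduli: the history dependence enters only through the printed face remark and (AF-1). [cite: Balaban1987RG1, Thm 2 (0.31) p.259 with (2.13) p.268 and §1 p.264] -/
theorem uniformTheorem2_iff_faceAF (hD : Definitions S) (hL : Odd S.L ∧ 1 < S.L) {γU b' C : ℝ} (hγU : 0 < γU) (hγUS : γU ≤ S.γ) (hC : 0 ≤ C)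
    (hcont : BetaContH γU S.β) (hup : BetaUpperH b' γU S.β) (hsmall : b' * γU ^ 2 < 1) (hAF1 : LastVarLipschitzAtZero S.β C γU) :
    (∀ m : ℕ, ∃ γ₁ : ℝ, 0 < γ₁ ∧ ∀ γ : ℝ, 0 < γ → γ ≤ γ₁ → ∃ g₁ : ℝ, 0 < g₁ ∧ ∃ β β' : ℝ, 0 < β ∧ β ≤ β' ∧
      ∀ g : ℝ, 0 < g → g ≤ g₁ → ∀ K : ℕ, ∃ g₀ : ℝ, Step.InInterval γ K (S.cpl ⟨K, m, g₀⟩) ∧ S.cpl ⟨K, m, g₀⟩ K = g ∧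
        Step.Discrete031 (β * Real.log S.L) (β' * Real.log S.L) K g (S.cpl ⟨K, m, g₀⟩)) ↔
    ∃ b : ℝ, 0 < b ∧ ∀ (k : ℕ) (q : Fin (k + 1) → ℝ), q ∈ Box γU k → b ≤ S.β k (Function.update q (Fin.last k) 0) := by
  constructor
  · intro hTu
    obtain ⟨β, β', hβ, -, hface⟩ :=
      face_bounds_of_uniformTheorem2_AF1 hD hL.2 hTu 0 hγU hγUS hC (hrg_of_betaUpperH hD hγU hup hsmall) hAF1
    exact ⟨β * Real.log S.L, mul_pos hβ (Real.log_pos (by exact_mod_cast hL.2)), fun k q hq => (hface k q hq).1⟩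
  · rintro ⟨b, hb, hface⟩
    exact (theorem2Statement_of_faceAF hD hL hγU hb hC hcont hup hface hAF1).1

end

end Summit.QuantumFields.BalabanUV.Beta.EriceFlowEnclosureB12AsPrintedPointwiseFaceIff
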